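import Mathlib
import HarnessLib
import Summits.NavierStokesRegularity.NavierStokesRegularity.Theorems.ChiralWindowDoorDefs
import Summits.NavierStokesRegularity.NavierStokesRegularity.Theorems.ChiralWindowDoorLambda

/-!
# Door S20 «ChiralWindowDoor» — uniform majorants, continuity, far-field decay and truncation limits for
# `Λ = (−Δ)^{1/2}` in second-difference form (B1′ steps (i)–(ii) of nsreg-p1's R19-LINE)

Door S20 of nsreg-p1's local Type-I door family (`HOME/ns-regularity-ideate-p1/r19/R19-LINE.md` §B1′, §PROGNOSIS;
DESIGN-ONLY, route NOT born).  For the truncated operators `L_ε f (x) = ∫ K_ε(z) • (2f(x) − f(x+z) − f(x−z)) dz`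
(`K_ε = lamKTrunc ε`; `ε = 0` IS the full kernel: `lamKTrunc 0 = lamK`, so `½ L_0 = fracLapHalf`) this file proves:

* `lamKTrunc_zero` — `lamKTrunc 0 = lamK`;
* `exists_majorant_secondDiff` / `exists_majorant_secondDiff_real` — an `x`-UNIFORM integrable majorant
  `lamK z · ‖2f(x) − f(x+z) − f(x−z)‖ ≤ g z` for a bounded field with quadratic second differences (vector / scalar);
* `continuous_secondDiffOp` (+ scalar twin) — `x ↦ ∫ K_ε(z) • (2f(x) − f(x+z) − f(x−z)) dz` is CONTINUOUS for every `ε ≥ 0`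
  (dominated continuity), and `norm_secondDiffOp_le` — it is bounded by `∫ g`, uniformly in `x` and `ε`;
* `abs_secondDiffOp_real_le_far` — **far-field decay of `Λ` on a compactly supported weight**: if `a = 0` off `B_ρ(0)` then
  for `‖x‖ ≥ 2ρ` and every `ε ≥ 0`, `|∫ K_ε(z)(2a(x) − a(x+z) − a(x−z)) dz| ≤ 32 ‖a‖_{L¹} · lamK x` (`≲ ρ³‖x‖⁻⁴` for a
  bump of radius `ρ` — the kernel bound `|Λ(η_R²)| ≲ R³‖x‖⁻⁴` of R19-LINE §B1′ (ii));
* `tendsto_secondDiffOp` (+ scalar twin) — **the truncation limit**: `∫ K_{1/(n+1)} • S → ∫ lamK • S` pointwise in `x`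
  (dominated convergence with the majorant).

Seat nsreg-p6 g11 (THEOREMS-ONLY door sequels, DIRECTOR-NS g8 #32 (2)/#36).  WHAT THIS IS NOT: not NS regularity
(Clay A); not B1′ — analysis of the substrate's `Λ` feeding `…ChiralWindowDoorGagliardoIdentity`; no route is opened.
-/

noncomputable section

-- the summit and its single sub-problem share the name (CONVENTIONS §1), as in every Theorems file
set_option linter.dupNamespace false

namespace Summit.NavierStokesRegularity.NavierStokesRegularity.Theorems.ChiralWindowDoorFracLapHalfBounds

open MeasureTheory Set Filter Topology Metric
open scoped RealInnerProductSpace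
open Summit.NavierStokesRegularity.NavierStokesRegularity.Theorems.ChiralWindowDoorDefs
open Summit.NavierStokesRegularity.NavierStokesRegularity.Theorems.ChiralWindowDoorLambda

/-! ### `ε = 0` is the full kernel -/

/-- `lamK 0 = 0` (Lean's `0⁻¹ = 0`). -/
theorem lamK_zero : lamK (0 : EuclideanSpace ℝ (Fin 3)) = 0 := by simp [lamK]

/-- `lamKTrunc 0 = lamK`: the truncation at radius `0` is the kernel itself (they differ at most at `z = 0`, where both
vanish). -/
theorem lamKTrunc_zero : lamKTrunc 0 = lamK := by
  funext z
  by_cases hz : z = 0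
  · subst hz; rw [lamK_zero, lamKTrunc_of_le (by simp)]
  · exact lamKTrunc_of_lt (norm_pos_iff.2 hz)

/-- For `0 ≤ ε`, `0 ≤ lamKTrunc ε z ≤ lamK z` packaged as a norm bound. -/
theorem norm_lamKTrunc_le (ε : ℝ) (z : EuclideanSpace ℝ (Fin 3)) : ‖lamKTrunc ε z‖ ≤ lamK z := by
  rw [Real.norm_eq_abs, abs_of_nonneg (lamKTrunc_nonneg ε z)]; exact lamKTrunc_le_lamK ε z

/-! ### Uniform integrable majorants -/

section Vector

variable {f : EuclideanSpace ℝ (Fin 3) → EuclideanSpace ℝ (Fin 3)} {M₀ M₂ : ℝ}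

/-- **An `x`-uniform integrable majorant of the `Λ`-integrand** of a bounded field with quadratic second differences:
`lamK z · ‖2f(x) − f(x+z) − f(x−z)‖ ≤ g z` for all `x, z`, with `g` integrable on `ℝ³` (near field `π⁻²M₂‖z‖⁻²` on the
unit ball, far field `4M₀ · lamKTrunc ½`). -/
theorem exists_majorant_secondDiff (hf0 : ∀ x, ‖f x‖ ≤ M₀)
    (hf2 : ∀ x z, ‖(2 : ℝ) • f x - f (x + z) - f (x - z)‖ ≤ M₂ * ‖z‖ ^ 2) :
    ∃ g : EuclideanSpace ℝ (Fin 3) → ℝ, Integrable g ∧ (∀ z, 0 ≤ g z) ∧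
      ∀ x z, lamK z * ‖(2 : ℝ) • f x - f (x + z) - f (x - z)‖ ≤ g z := by
  have hM₀ : 0 ≤ M₀ := (norm_nonneg _).trans (hf0 0)
  have hM₂ : 0 ≤ M₂ := by
    by_contra h
    push Not at h
    obtain ⟨z, hz⟩ : ∃ z : EuclideanSpace ℝ (Fin 3), z ≠ 0 := exists_ne 0
    have h1 := hf2 0 z
    have : M₂ * ‖z‖ ^ 2 < 0 := mul_neg_of_neg_of_pos h (by positivity)
    linarith [norm_nonneg ((2 : ℝ) • f 0 - f (0 + z) - f (0 - z))]
  refine ⟨fun z => (ball (0 : EuclideanSpace ℝ (Fin 3)) 1).indicator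
      (fun z => (1 / Real.pi ^ 2 * M₂) * ‖z‖ ^ (-(2 : ℝ))) z + 4 * M₀ * lamKTrunc (1 / 2) z, ?_, ?_, ?_⟩
  · refine Integrable.add ?_ ((integrable_lamKTrunc (by norm_num : (0 : ℝ) < 1 / 2)).const_mul _)
    refine IntegrableOn.integrable_indicator ?_ measurableSet_ball
    have hmeas : Measurable fun z : EuclideanSpace ℝ (Fin 3) => (1 / Real.pi ^ 2 * M₂) * ‖z‖ ^ (-(2 : ℝ)) :=
      Measurable.const_mul (continuous_norm.measurable.pow_const _) _
    exact integrableOn_ball_of_norm_le_rpow (E := EuclideanSpace ℝ (Fin 3)) (F := ℝ) (μ := volume)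
      (f := fun z => (1 / Real.pi ^ 2 * M₂) * ‖z‖ ^ (-(2 : ℝ)))
      (by rw [finrank_euclideanSpace_fin]; norm_num) (C := 1 / Real.pi ^ 2 * M₂) (α := 2) (r := 1)
      (by rw [finrank_euclideanSpace_fin]; norm_num)
      (ae_of_all _ fun z => by rw [Real.norm_eq_abs, abs_of_nonneg (by positivity)])
      hmeas.aestronglyMeasurable
  · intro z
    dsimp only
    refine add_nonneg ?_ (by have := lamKTrunc_nonneg (1 / 2) z; positivity)
    by_cases hz : z ∈ ball (0 : EuclideanSpace ℝ (Fin 3)) 1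
    · rw [indicator_of_mem hz]; positivity
    · rw [indicator_of_notMem hz]
  · intro x z
    dsimp only
    by_cases hz : z ∈ ball (0 : EuclideanSpace ℝ (Fin 3)) 1
    · rw [indicator_of_mem hz]
      have h1 : lamK z * ‖(2 : ℝ) • f x - f (x + z) - f (x - z)‖ ≤ (1 / Real.pi ^ 2 * M₂) * ‖z‖ ^ (-(2 : ℝ)) :=
        (mul_le_mul_of_nonneg_left (hf2 x z) (lamK_nonneg z)).trans (lamK_mul_sq_le hM₂ z)
      have h2 : 0 ≤ 4 * M₀ * lamKTrunc (1 / 2) z := by have := lamKTrunc_nonneg (1 / 2) z; positivity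
      linarith
    · rw [indicator_of_notMem hz, zero_add]
      have hz1 : 1 ≤ ‖z‖ := by simpa [mem_ball, dist_zero_right] using hz
      have hK : lamKTrunc (1 / 2) z = lamK z := lamKTrunc_of_lt (by linarith)
      have hD : ‖(2 : ℝ) • f x - f (x + z) - f (x - z)‖ ≤ 4 * M₀ := by
        calc ‖(2 : ℝ) • f x - f (x + z) - f (x - z)‖
            ≤ ‖(2 : ℝ) • f x‖ + ‖f (x + z)‖ + ‖f (x - z)‖ := by
              calc _ ≤ ‖(2 : ℝ) • f x - f (x + z)‖ + ‖f (x - z)‖ := norm_sub_le _ _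
                _ ≤ _ := by gcongr; exact norm_sub_le _ _
          _ ≤ 2 * M₀ + M₀ + M₀ := by
              rw [norm_smul, Real.norm_eq_abs, abs_of_pos (by norm_num : (0 : ℝ) < 2)]
              gcongr <;> exact hf0 _
          _ = 4 * M₀ := by ring
      calc lamK z * ‖(2 : ℝ) • f x - f (x + z) - f (x - z)‖ ≤ lamK z * (4 * M₀) :=
            mul_le_mul_of_nonneg_left hD (lamK_nonneg z)
        _ = 4 * M₀ * lamKTrunc (1 / 2) z := by rw [hK]; ring

/-- **Continuity of the truncated / full second-difference operator** `x ↦ ∫ K_ε(z) • (2f(x) − f(x+z) − f(x−z)) dz`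
(`ε ≥ 0` arbitrary; `ε = 0` is `2 • fracLapHalf f`), for a bounded continuous field with quadratic second differences. -/
theorem continuous_secondDiffOp (hfc : Continuous f) (hf0 : ∀ x, ‖f x‖ ≤ M₀)
    (hf2 : ∀ x z, ‖(2 : ℝ) • f x - f (x + z) - f (x - z)‖ ≤ M₂ * ‖z‖ ^ 2) (ε : ℝ) :
    Continuous fun x => ∫ z, lamKTrunc ε z • ((2 : ℝ) • f x - f (x + z) - f (x - z)) := by
  obtain ⟨g, hgi, -, hg⟩ := exists_majorant_secondDiff hf0 hf2
  refine continuous_of_dominated (bound := g) (fun x => ?_) (fun x => ae_of_all _ fun z => ?_) hgi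
    (ae_of_all _ fun z => ?_)
  · exact ((measurable_lamKTrunc ε).smul
      (by fun_prop : Continuous fun z => (2 : ℝ) • f x - f (x + z) - f (x - z)).measurable).aestronglyMeasurable
  · rw [norm_smul]
    exact (mul_le_mul_of_nonneg_right (norm_lamKTrunc_le ε z) (norm_nonneg _)).trans (hg x z)
  · exact (by fun_prop : Continuous fun x => lamKTrunc ε z • ((2 : ℝ) • f x - f (x + z) - f (x - z)))

/-- The truncated / full integrand is integrable for every `x` and every `ε ≥ 0`. -/
theorem integrable_secondDiffOp (hfc : Continuous f) (hf0 : ∀ x, ‖f x‖ ≤ M₀)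
    (hf2 : ∀ x z, ‖(2 : ℝ) • f x - f (x + z) - f (x - z)‖ ≤ M₂ * ‖z‖ ^ 2) (ε : ℝ) (x : EuclideanSpace ℝ (Fin 3)) :
    Integrable (fun z => lamKTrunc ε z • ((2 : ℝ) • f x - f (x + z) - f (x - z))) := by
  obtain ⟨g, hgi, -, hg⟩ := exists_majorant_secondDiff hf0 hf2
  refine hgi.mono' ?_ (ae_of_all _ fun z => ?_)
  · exact ((measurable_lamKTrunc ε).smul
      (by fun_prop : Continuous fun z => (2 : ℝ) • f x - f (x + z) - f (x - z)).measurable).aestronglyMeasurable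
  · rw [norm_smul]
    exact (mul_le_mul_of_nonneg_right (norm_lamKTrunc_le ε z) (norm_nonneg _)).trans (hg x z)

/-- **Uniform bound**: with the majorant `g` of `exists_majorant_secondDiff`,
`‖∫ K_ε(z) • (2f(x) − f(x+z) − f(x−z)) dz‖ ≤ ∫ g` for all `x` and all `ε`. -/
theorem norm_secondDiffOp_le {g : EuclideanSpace ℝ (Fin 3) → ℝ} (hgi : Integrable g)
    (hg : ∀ x z, lamK z * ‖(2 : ℝ) • f x - f (x + z) - f (x - z)‖ ≤ g z) (ε : ℝ) (x : EuclideanSpace ℝ (Fin 3)) :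
    ‖∫ z, lamKTrunc ε z • ((2 : ℝ) • f x - f (x + z) - f (x - z))‖ ≤ ∫ z, g z := by
  refine (norm_integral_le_integral_norm _).trans (integral_mono_of_nonneg (ae_of_all _ fun z => norm_nonneg _) hgi
    (ae_of_all _ fun z => ?_))
  dsimp only
  rw [norm_smul]
  exact (mul_le_mul_of_nonneg_right (norm_lamKTrunc_le ε z) (norm_nonneg _)).trans (hg x z)

/-- **The truncation limit** (dominated convergence): for every `x`,
`∫ K_{1/(n+1)}(z) • (2f(x) − f(x+z) − f(x−z)) dz → ∫ lamK z • (2f(x) − f(x+z) − f(x−z)) dz`. -/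
theorem tendsto_secondDiffOp (hfc : Continuous f) (hf0 : ∀ x, ‖f x‖ ≤ M₀)
    (hf2 : ∀ x z, ‖(2 : ℝ) • f x - f (x + z) - f (x - z)‖ ≤ M₂ * ‖z‖ ^ 2) (x : EuclideanSpace ℝ (Fin 3)) :
    Tendsto (fun n : ℕ => ∫ z, lamKTrunc (1 / ((n : ℝ) + 1)) z • ((2 : ℝ) • f x - f (x + z) - f (x - z)))
      atTop (𝓝 (∫ z, lamK z • ((2 : ℝ) • f x - f (x + z) - f (x - z)))) := by
  obtain ⟨g, hgi, -, hg⟩ := exists_majorant_secondDiff hf0 hf2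
  refine tendsto_integral_of_dominated_convergence g (fun n => ?_) hgi (fun n => ae_of_all _ fun z => ?_)
    (ae_of_all _ fun z => ?_)
  · exact ((measurable_lamKTrunc _).smul
      (by fun_prop : Continuous fun z => (2 : ℝ) • f x - f (x + z) - f (x - z)).measurable).aestronglyMeasurable
  · rw [norm_smul]
    exact (mul_le_mul_of_nonneg_right (norm_lamKTrunc_le _ z) (norm_nonneg _)).trans (hg x z)
  · -- eventually the truncation does not see `z`
    by_cases hz : z = 0
    · subst hz
      have h0 : ∀ n : ℕ, lamKTrunc (1 / ((n : ℝ) + 1)) (0 : EuclideanSpace ℝ (Fin 3)) = 0 := fun n =>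
        lamKTrunc_of_le (by rw [norm_zero]; positivity)
      simp only [h0, lamK_zero]
      exact tendsto_const_nhds
    · have hzpos : 0 < ‖z‖ := norm_pos_iff.2 hz
      obtain ⟨N, hN⟩ := exists_nat_one_div_lt hzpos
      refine tendsto_const_nhds.congr' ?_
      filter_upwards [Filter.eventually_ge_atTop N] with n hn
      have hlt : 1 / ((n : ℝ) + 1) < ‖z‖ := by
        refine lt_of_le_of_lt ?_ hN
        gcongr
      rw [lamKTrunc_of_lt hlt]

end Vector

section Scalar

variable {a : EuclideanSpace ℝ (Fin 3) → ℝ} {A₀ A₂ : ℝ}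

/-- **An `x`-uniform integrable majorant of the scalar `Λ`-integrand** (`|a| ≤ A₀`, `|2a(x) − a(x+z) − a(x−z)| ≤ A₂‖z‖²`). -/
theorem exists_majorant_secondDiff_real (ha0 : ∀ x, |a x| ≤ A₀)
    (ha2 : ∀ x z, |2 * a x - a (x + z) - a (x - z)| ≤ A₂ * ‖z‖ ^ 2) :
    ∃ g : EuclideanSpace ℝ (Fin 3) → ℝ, Integrable g ∧ (∀ z, 0 ≤ g z) ∧
      ∀ x z, lamK z * |2 * a x - a (x + z) - a (x - z)| ≤ g z := by
  have hA₀ : 0 ≤ A₀ := (abs_nonneg _).trans (ha0 0)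
  have hA₂ : 0 ≤ A₂ := by
    by_contra h
    push Not at h
    obtain ⟨z, hz⟩ : ∃ z : EuclideanSpace ℝ (Fin 3), z ≠ 0 := exists_ne 0
    have h1 := ha2 0 z
    have : A₂ * ‖z‖ ^ 2 < 0 := mul_neg_of_neg_of_pos h (by positivity)
    linarith [abs_nonneg (2 * a 0 - a (0 + z) - a (0 - z))]
  refine ⟨fun z => (ball (0 : EuclideanSpace ℝ (Fin 3)) 1).indicator
      (fun z => (1 / Real.pi ^ 2 * A₂) * ‖z‖ ^ (-(2 : ℝ))) z + 4 * A₀ * lamKTrunc (1 / 2) z, ?_, ?_, ?_⟩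
  · refine Integrable.add ?_ ((integrable_lamKTrunc (by norm_num : (0 : ℝ) < 1 / 2)).const_mul _)
    refine IntegrableOn.integrable_indicator ?_ measurableSet_ball
    have hmeas : Measurable fun z : EuclideanSpace ℝ (Fin 3) => (1 / Real.pi ^ 2 * A₂) * ‖z‖ ^ (-(2 : ℝ)) :=
      Measurable.const_mul (continuous_norm.measurable.pow_const _) _
    exact integrableOn_ball_of_norm_le_rpow (E := EuclideanSpace ℝ (Fin 3)) (F := ℝ) (μ := volume)
      (f := fun z => (1 / Real.pi ^ 2 * A₂) * ‖z‖ ^ (-(2 : ℝ)))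
      (by rw [finrank_euclideanSpace_fin]; norm_num) (C := 1 / Real.pi ^ 2 * A₂) (α := 2) (r := 1)
      (by rw [finrank_euclideanSpace_fin]; norm_num)
      (ae_of_all _ fun z => by rw [Real.norm_eq_abs, abs_of_nonneg (by positivity)])
      hmeas.aestronglyMeasurable
  · intro z
    dsimp only
    refine add_nonneg ?_ (by have := lamKTrunc_nonneg (1 / 2) z; positivity)
    by_cases hz : z ∈ ball (0 : EuclideanSpace ℝ (Fin 3)) 1
    · rw [indicator_of_mem hz]; positivity
    · rw [indicator_of_notMem hz]
  · intro x z
    dsimp only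
    by_cases hz : z ∈ ball (0 : EuclideanSpace ℝ (Fin 3)) 1
    · rw [indicator_of_mem hz]
      have h1 : lamK z * |2 * a x - a (x + z) - a (x - z)| ≤ (1 / Real.pi ^ 2 * A₂) * ‖z‖ ^ (-(2 : ℝ)) :=
        (mul_le_mul_of_nonneg_left (ha2 x z) (lamK_nonneg z)).trans (lamK_mul_sq_le hA₂ z)
      have h2 : 0 ≤ 4 * A₀ * lamKTrunc (1 / 2) z := by have := lamKTrunc_nonneg (1 / 2) z; positivity
      linarith
    · rw [indicator_of_notMem hz, zero_add]
      have hz1 : 1 ≤ ‖z‖ := by simpa [mem_ball, dist_zero_right] using hz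
      have hK : lamKTrunc (1 / 2) z = lamK z := lamKTrunc_of_lt (by linarith)
      have hD : |2 * a x - a (x + z) - a (x - z)| ≤ 4 * A₀ := by
        calc |2 * a x - a (x + z) - a (x - z)| ≤ |2 * a x - a (x + z)| + |a (x - z)| := abs_sub _ _
          _ ≤ |2 * a x| + |a (x + z)| + |a (x - z)| := by gcongr; exact abs_sub _ _
          _ ≤ 2 * A₀ + A₀ + A₀ := by
              rw [abs_mul, abs_of_pos (by norm_num : (0 : ℝ) < 2)]
              gcongr <;> exact ha0 _
          _ = 4 * A₀ := by ring
      calc lamK z * |2 * a x - a (x + z) - a (x - z)| ≤ lamK z * (4 * A₀) :=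
            mul_le_mul_of_nonneg_left hD (lamK_nonneg z)
        _ = 4 * A₀ * lamKTrunc (1 / 2) z := by rw [hK]; ring

/-- Continuity of the scalar truncated / full second-difference operator. -/
theorem continuous_secondDiffOp_real (hac : Continuous a) (ha0 : ∀ x, |a x| ≤ A₀)
    (ha2 : ∀ x z, |2 * a x - a (x + z) - a (x - z)| ≤ A₂ * ‖z‖ ^ 2) (ε : ℝ) :
    Continuous fun x => ∫ z, lamKTrunc ε z * (2 * a x - a (x + z) - a (x - z)) := by
  obtain ⟨g, hgi, -, hg⟩ := exists_majorant_secondDiff_real ha0 ha2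
  refine continuous_of_dominated (bound := g) (fun x => ?_) (fun x => ae_of_all _ fun z => ?_) hgi
    (ae_of_all _ fun z => ?_)
  · exact ((measurable_lamKTrunc ε).mul
      (by fun_prop : Continuous fun z => 2 * a x - a (x + z) - a (x - z)).measurable).aestronglyMeasurable
  · rw [norm_mul, Real.norm_eq_abs (2 * a x - _ - _)]
    exact (mul_le_mul_of_nonneg_right (norm_lamKTrunc_le ε z) (abs_nonneg _)).trans (hg x z)
  · exact (by fun_prop : Continuous fun x => lamKTrunc ε z * (2 * a x - a (x + z) - a (x - z)))

/-- Integrability of the scalar truncated / full integrand. -/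
theorem integrable_secondDiffOp_real (hac : Continuous a) (ha0 : ∀ x, |a x| ≤ A₀)
    (ha2 : ∀ x z, |2 * a x - a (x + z) - a (x - z)| ≤ A₂ * ‖z‖ ^ 2) (ε : ℝ) (x : EuclideanSpace ℝ (Fin 3)) :
    Integrable (fun z => lamKTrunc ε z * (2 * a x - a (x + z) - a (x - z))) := by
  obtain ⟨g, hgi, -, hg⟩ := exists_majorant_secondDiff_real ha0 ha2
  refine hgi.mono' ?_ (ae_of_all _ fun z => ?_)
  · exact ((measurable_lamKTrunc ε).mul
      (by fun_prop : Continuous fun z => 2 * a x - a (x + z) - a (x - z)).measurable).aestronglyMeasurable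
  · rw [norm_mul, Real.norm_eq_abs (2 * a x - _ - _)]
    exact (mul_le_mul_of_nonneg_right (norm_lamKTrunc_le ε z) (abs_nonneg _)).trans (hg x z)

/-- Uniform bound for the scalar operator. -/
theorem abs_secondDiffOp_real_le {g : EuclideanSpace ℝ (Fin 3) → ℝ} (hgi : Integrable g)
    (hg : ∀ x z, lamK z * |2 * a x - a (x + z) - a (x - z)| ≤ g z) (ε : ℝ) (x : EuclideanSpace ℝ (Fin 3)) :
    |∫ z, lamKTrunc ε z * (2 * a x - a (x + z) - a (x - z))| ≤ ∫ z, g z := by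
  rw [← Real.norm_eq_abs]
  refine (norm_integral_le_integral_norm _).trans (integral_mono_of_nonneg (ae_of_all _ fun z => norm_nonneg _) hgi
    (ae_of_all _ fun z => ?_))
  dsimp only
  rw [norm_mul, Real.norm_eq_abs (2 * a x - _ - _)]
  exact (mul_le_mul_of_nonneg_right (norm_lamKTrunc_le ε z) (abs_nonneg _)).trans (hg x z)

/-- **Far-field decay of the (truncated or full) scalar operator on a compactly supported weight**: if `a = 0` off
`B_ρ(0)` and `a` is integrable, then for `‖x‖ ≥ 2ρ > 0` and every `ε`,
`|∫ K_ε(z)(2a(x) − a(x+z) − a(x−z)) dz| ≤ 32 ‖a‖_{L¹} · lamK x`  (on the support of `a(x ± z)` one has `‖z‖ ≥ ‖x‖/2`,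
where `K_ε ≤ lamK ≤ 16 lamK x`). -/
theorem abs_secondDiffOp_real_le_far (hai : Integrable a) {ρ : ℝ} (hρ : 0 < ρ)
    (hsupp : ∀ x, ρ ≤ ‖x‖ → a x = 0) (ε : ℝ) {x : EuclideanSpace ℝ (Fin 3)} (hx : 2 * ρ ≤ ‖x‖) :
    |∫ z, lamKTrunc ε z * (2 * a x - a (x + z) - a (x - z))| ≤ 32 * (∫ y, |a y|) * lamK x := by
  have hx0 : 0 < ‖x‖ := by linarith
  have hax : a x = 0 := hsupp x (by linarith)
  -- pointwise: `K_ε z |a (x ± z)| ≤ 16 lamK x |a (x ± z)|`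
  have hker : ∀ w : EuclideanSpace ℝ (Fin 3), (w = x ∨ True) → ∀ z : EuclideanSpace ℝ (Fin 3),
      lamKTrunc ε z * |a (x + z)| ≤ 16 * lamK x * |a (x + z)| ∧
        lamKTrunc ε z * |a (x - z)| ≤ 16 * lamK x * |a (x - z)| := by
    intro _ _ z
    have key : ∀ s : EuclideanSpace ℝ (Fin 3), (s = x + z ∨ s = x - z) → ‖s - x‖ = ‖z‖ →
        lamKTrunc ε z * |a s| ≤ 16 * lamK x * |a s| := by
      intro s _ hs
      by_cases has : a s = 0
      · simp [has]
      · have hsρ : ‖s‖ < ρ := by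
          by_contra h
          exact has (hsupp s (not_lt.1 h))
        have hz : ‖x‖ / 2 ≤ ‖z‖ := by
          have : ‖x‖ ≤ ‖s‖ + ‖s - x‖ := by
            calc ‖x‖ = ‖s - (s - x)‖ := by rw [sub_sub_cancel]
              _ ≤ ‖s‖ + ‖s - x‖ := norm_sub_le _ _
          rw [hs] at this
          linarith
        have hzpos : 0 < ‖z‖ := by linarith
        have hK : lamKTrunc ε z ≤ 16 * lamK x := by
          calc lamKTrunc ε z ≤ lamK z := lamKTrunc_le_lamK ε z
            _ = (1 / Real.pi ^ 2) * (‖z‖ ^ 4)⁻¹ := rfl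
            _ ≤ (1 / Real.pi ^ 2) * ((‖x‖ / 2) ^ 4)⁻¹ :=
                mul_le_mul_of_nonneg_left (inv_anti₀ (by positivity) (pow_le_pow_left₀ (by positivity) hz 4))
                  (by positivity)
            _ = 16 * lamK x := by
                unfold lamK
                rw [div_pow, inv_div]
                have : ‖x‖ ^ 4 ≠ 0 := by positivity
                field_simp
                norm_num
        exact mul_le_mul_of_nonneg_right hK (abs_nonneg _)
    exact ⟨key (x + z) (Or.inl rfl) (by rw [add_sub_cancel_left]),
      key (x - z) (Or.inr rfl) (by rw [sub_sub_cancel_left, norm_neg])⟩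
  -- integrability of the two translates
  have hi1 : Integrable (fun z : EuclideanSpace ℝ (Fin 3) => |a (x + z)|) := by
    have h := (hai.comp_add_left x).norm
    simpa [Real.norm_eq_abs] using h
  have hi2 : Integrable (fun z : EuclideanSpace ℝ (Fin 3) => |a (x - z)|) := by
    have h := (hai.comp_sub_left x).norm
    simpa [Real.norm_eq_abs] using h
  have hI1 : ∫ z : EuclideanSpace ℝ (Fin 3), |a (x + z)| = ∫ y, |a y| :=
    integral_add_left_eq_self (μ := volume) (fun y => |a y|) x
  have hI2 : ∫ z : EuclideanSpace ℝ (Fin 3), |a (x - z)| = ∫ y, |a y| :=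
    integral_sub_left_eq_self (μ := volume) (fun y => |a y|) x
  -- the estimate
  have hdom : Integrable (fun z : EuclideanSpace ℝ (Fin 3) => 16 * lamK x * |a (x + z)| + 16 * lamK x * |a (x - z)|) :=
    (hi1.const_mul _).add (hi2.const_mul _)
  calc |∫ z, lamKTrunc ε z * (2 * a x - a (x + z) - a (x - z))|
      ≤ ∫ z, |lamKTrunc ε z * (2 * a x - a (x + z) - a (x - z))| := abs_integral_le_integral_abs
    _ ≤ ∫ z, (16 * lamK x * |a (x + z)| + 16 * lamK x * |a (x - z)|) := by
        refine integral_mono_of_nonneg (ae_of_all _ fun z => abs_nonneg _) hdom (ae_of_all _ fun z => ?_)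
        have h := hker x (Or.inl rfl) z
        dsimp only
        have hrew : lamKTrunc ε z * (2 * a x - a (x + z) - a (x - z)) =
            -(lamKTrunc ε z * a (x + z)) - lamKTrunc ε z * a (x - z) := by rw [hax]; ring
        rw [hrew]
        calc |-(lamKTrunc ε z * a (x + z)) - lamKTrunc ε z * a (x - z)|
            ≤ |-(lamKTrunc ε z * a (x + z))| + |lamKTrunc ε z * a (x - z)| := abs_sub _ _
          _ = lamKTrunc ε z * |a (x + z)| + lamKTrunc ε z * |a (x - z)| := by
              rw [abs_neg, abs_mul, abs_mul, abs_of_nonneg (lamKTrunc_nonneg ε z)]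
          _ ≤ 16 * lamK x * |a (x + z)| + 16 * lamK x * |a (x - z)| := add_le_add h.1 h.2
    _ = 16 * lamK x * (∫ y, |a y|) + 16 * lamK x * ∫ y, |a y| := by
        rw [integral_add (hi1.const_mul _) (hi2.const_mul _), integral_const_mul, integral_const_mul, hI1, hI2]
    _ = 32 * (∫ y, |a y|) * lamK x := by ring

/-- **The truncation limit, scalar version**: `∫ K_{1/(n+1)}(z)(2a(x) − a(x+z) − a(x−z)) dz → ∫ lamK z (…) dz`. -/
theorem tendsto_secondDiffOp_real (hac : Continuous a) (ha0 : ∀ x, |a x| ≤ A₀)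
    (ha2 : ∀ x z, |2 * a x - a (x + z) - a (x - z)| ≤ A₂ * ‖z‖ ^ 2) (x : EuclideanSpace ℝ (Fin 3)) :
    Tendsto (fun n : ℕ => ∫ z, lamKTrunc (1 / ((n : ℝ) + 1)) z * (2 * a x - a (x + z) - a (x - z)))
      atTop (𝓝 (∫ z, lamK z * (2 * a x - a (x + z) - a (x - z)))) := by
  obtain ⟨g, hgi, -, hg⟩ := exists_majorant_secondDiff_real ha0 ha2
  refine tendsto_integral_of_dominated_convergence g (fun n => ?_) hgi (fun n => ae_of_all _ fun z => ?_)
    (ae_of_all _ fun z => ?_)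
  · exact ((measurable_lamKTrunc _).mul
      (by fun_prop : Continuous fun z => 2 * a x - a (x + z) - a (x - z)).measurable).aestronglyMeasurable
  · rw [norm_mul, Real.norm_eq_abs (2 * a x - _ - _)]
    exact (mul_le_mul_of_nonneg_right (norm_lamKTrunc_le _ z) (abs_nonneg _)).trans (hg x z)
  · by_cases hz : z = 0
    · subst hz
      have h0 : ∀ n : ℕ, lamKTrunc (1 / ((n : ℝ) + 1)) (0 : EuclideanSpace ℝ (Fin 3)) = 0 := fun n =>
        lamKTrunc_of_le (by rw [norm_zero]; positivity)
      simp only [h0, lamK_zero]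
      exact tendsto_const_nhds
    · have hzpos : 0 < ‖z‖ := norm_pos_iff.2 hz
      obtain ⟨N, hN⟩ := exists_nat_one_div_lt hzpos
      refine tendsto_const_nhds.congr' ?_
      filter_upwards [Filter.eventually_ge_atTop N] with n hn
      have hlt : 1 / ((n : ℝ) + 1) < ‖z‖ := by
        refine lt_of_le_of_lt ?_ hN
        gcongr
      rw [lamKTrunc_of_lt hlt]

end Scalar

end Summit.NavierStokesRegularity.NavierStokesRegularity.Theorems.ChiralWindowDoorFracLapHalfBounds
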